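import Summits.AtomisticToContinuum.HydrodynamicLimit.Theorems.RelayRaceLocalityNearConstantShortTimeHLAssemblyDefs
import Summits.AtomisticToContinuum.HydrodynamicLimit.Theorems.RelayRaceLocalityNearConstantShortTimeHLAssemblyTheta
import Summits.AtomisticToContinuum.HydrodynamicLimit.Theorems.RelayRaceLocalityNearConstantShortTimeHLGronwallReduction
import HarnessLib

/-!
# Crux `NearConstantShortTimeHL` (stmt-AtomisticToContinuum-12502), line `small-tilt-domination` — the DYNAMIC THEOREM AT FIXED DATA as a named
statement (`DynamicTheorem`)

Level 1 of the Grönwall assembly of the line (`stub_gronwallAssembly = stub_reduction ∘ stub_dynamic`, skeleton v8–v11): Yau's relative-entropy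
Grönwall along ONE classical hs-Euler solution, one admissible family and one family of flows, at fixed data — the hypothesis type of the tree
theorem `stub_reduction` (`Theorems/…GronwallReduction.lean`, p130680). It is stated here VERBATIM as a `Prop`-valued definition so that the
registered skeleton stub can read `stub_dynamic : DynamicTheorem`: the unfolded statement is ≈ 3.9 k characters long and exceeds what the stub
registry stores of a signature, so a proof file of the unfolded form can never pass the gate's name-+-signature check (this is why the previous
lead's 395-line proof p131684 bounced `supports.stub-mismatch` once the farm verified it). No mathematics here.

Informal content: given the analytic EOS branch, the solution on `[0,T)`, `t < min T 1` with packing `< η₀`, unit mass, the matched canonical local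
Gibbs laws `P_N` (probability), the pressures (`π₀`, `πst` uniformly on `[0,t]`), the initial mean of the log-profile observable and its
integrability, isentropy, the statics input St2′ at exponent `γ` (every `κ`), the speed / ball-packing caps in probability, Gaussian velocity tails
in mean along the true law, the event import `P_N ≤ e^{a_I n} G_N` with `a_I < c₀`, and the equilibrium closure bounds for momentum / energy defects
under `G_N` at rate `c₀`: for every `κ > 0`, eventually in `N`, the log-profile observable at time `t` along the flow is integrable and its mean is
at least `H(t) − κ`, `H(t) = ∫ ρ_t (log ρ_t + gChem σ ρ_t − 3/2 log(2πθ_t) − 3/2)`.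

References: H.-T. Yau, Lett. Math. Phys. 22 (1991) §2.
-/

noncomputable section

namespace Summit.AtomisticToContinuum.HydrodynamicLimit.Theorems.NearConstantShortTimeHL

open scoped BigOperators ENNReal
open MeasureTheory Set Filter Topology
open Literature.MathematicalPhysics.KineticTheory Literature.Analysis.FluidPDE Literature.Analysis.FunctionSpaces

/-- **THE DYNAMIC THEOREM AT FIXED DATA** (level 1 of the Grönwall assembly of the line `small-tilt-domination`; verbatim the hypothesis type of
`stub_reduction`): Yau's relative-entropy Grönwall along one classical hs-Euler solution / admissible family / family of flows — from good events,
window and cell estimates, the entropy price of the mesoscale fluctuation (St2′), the statics of the pressures and isentropy, and the discrete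
Grönwall over a diagonal grid, the mean of the log-profile observable at time `t` stays within every `κ` of its Euler value. [cite: Yau1991, §2] -/
@[conjecture] def DynamicTheorem : Prop :=
    ∀ {η₀ : ℝ} {F : ℝ → ℝ} (hη₀ : 0 < η₀) (hFa : AnalyticOnNhd ℝ F (Set.Ioo (-η₀) η₀))
    (hEq : Set.EqOn hsExcessFreeEnergy F (Set.Ico 0 η₀))
    {σ T : ℝ} (hσ : 0 < σ) {ρ θ : ℝ → T3 → ℝ} {u : ℝ → T3 → V3} (hE : IsHardSphereEulerSolution σ T ρ u θ)
    {t : ℝ} (ht : t ∈ Set.Ico 0 T) (ht1 : t < 1) (hband : ∀ s ∈ Set.Icc 0 t, ∀ x, ρ s x * σ ^ 3 < η₀)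
    (hmass : ∫ x, ρ 0 x = 1)
    {ηP : ℝ} (hηP : 0 < ηP) (hηP₀ : ηP < η₀)
    {ε : ℕ → ℝ} {n : ℕ → ℕ} (hn : Tendsto n atTop atTop) (hε : ∀ N, 0 < ε N)
    (Φ : (N : ℕ) → HardSphereFlow (Torus.geometry (Fin 3)) (ε N) (n N))
    (P : (N : ℕ) → Measure (Config (n N) (Fin 3) T3))
    (hPdef : ∀ N, P N = particleLaw (Φ N) (canonicalDensity (Torus.geometry (Fin 3)) (ε N) (n N)
    (localGibbsProfile (fun x => ρ 0 x * Real.exp (gChem σ (ρ 0 x))) (u 0) (θ 0))))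
    (hP : ∀ N, IsProbabilityMeasure (P N))
    {π₀ : ℝ} {πst : ℝ → ℝ}
    (hπ₀ : Tendsto (fun N => (n N : ℝ)⁻¹ * Real.log (canonicalPartition (Torus.geometry (Fin 3)) (ε N) (n N)
    (localGibbsProfile (fun x => ρ 0 x * Real.exp (gChem σ (ρ 0 x))) (u 0) (θ 0)))) atTop (nhds π₀))
    (hπ : TendstoUniformlyOn (fun N r => (n N : ℝ)⁻¹ * Real.log (canonicalPartition (Torus.geometry (Fin 3)) (ε N) (n N)
    (localGibbsProfile (fun x => ρ r x * Real.exp (gChem σ (ρ r x))) (u r) (θ r)))) πst atTop (Set.Icc 0 t))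
    (hm₀ : Tendsto (fun N => ∫ z, logProfileObs σ ρ θ u 0 z ∂(P N)) atTop
    (nhds (∫ x, ρ 0 x * (Real.log (ρ 0 x) + gChem σ (ρ 0 x) - 3 / 2 * Real.log (2 * Real.pi * θ 0 x) - 3 / 2))))
    (hm₀i : ∀ᶠ N : ℕ in atTop, Integrable (fun z => logProfileObs σ ρ θ u 0 z) (P N))
    (hiso : ∀ r ∈ Set.Icc 0 t,
    (∫ x, ρ 0 x * (Real.log (ρ 0 x) + gChem σ (ρ 0 x) - 3 / 2 * Real.log (2 * Real.pi * θ 0 x) - 3 / 2)) - π₀ =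
    (∫ x, ρ r x * (Real.log (ρ r x) + gChem σ (ρ r x) - 3 / 2 * Real.log (2 * Real.pi * θ r x) - 3 / 2)) - πst r)
    {γ : ℝ} (hγ : 0 < γ)
    (hSt2 : ∀ κ : ℝ, 0 < κ → ∀ᶠ N : ℕ in atTop, ∀ r ∈ Set.Icc 0 t,
    ∫⁻ w, ENNReal.ofReal (Real.exp (γ * (n N : ℝ) * fluctuationE (mesoRadius (n N)) (ρ r) (θ r) (u r) w))
    ∂(particleLaw (Φ N) (canonicalDensity (Torus.geometry (Fin 3)) (ε N) (n N)
    (localGibbsProfile (fun x => ρ r x * Real.exp (gChem σ (ρ r x))) (u r) (θ r)))) ≤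
    ENNReal.ofReal (Real.exp (κ * (n N : ℝ))))
    (hcapV : Tendsto (fun N => P N {z | ∃ r ∈ Set.Icc 0 t, ∃ i, (n N : ℝ) ^ (1 / 24 : ℝ) < ‖((Φ N).flow r z i).2‖})
    atTop (nhds 0))
    (hcapP : Tendsto (fun N => P N {z | ∃ r ∈ Set.Icc 0 t, ∃ x : T3,
    ηP < empiricalDensityField ((Φ N).flow r z) (ballKernel (mesoRadius (n N)) x) * σ ^ 3}) atTop (nhds 0))
    {a A : ℝ} (ha : 0 < a) (hA : 0 ≤ A)
    (hgauss : ∀ᶠ N : ℕ in atTop, ∀ s ∈ Set.Icc 0 t,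
    ∫⁻ z, ENNReal.ofReal ((n N : ℝ)⁻¹ * ∑ i : Fin (n N), Real.exp (a * ‖((Φ N).flow s z i).2‖ ^ 2)) ∂(P N) ≤
    ENNReal.ofReal A)
    (G : (N : ℕ) → Measure (Config (n N) (Fin 3) T3)) {aI c₀ : ℝ} (haI : aI < c₀)
    (hImp : ∀ N (S : Set (Config (n N) (Fin 3) T3)), P N S ≤ ENNReal.ofReal (Real.exp (aI * n N)) * G N S)
    {η₂ η₃ : ℝ} (hη₂ : ηP ≤ η₂) (hη₃ : ηP ≤ η₃)
    (hKmom : ∀ (s τ : ℝ), 0 ≤ s → 0 < τ → s + τ ≤ 1 →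
    ∀ ψ : ℝ → T3 → V3, Torus.IsSmoothSpaceTimeOn (Set.Icc s (s + τ)) ψ →
    (∀ r ∈ Set.Icc s (s + τ), ∀ x, ‖ψ r x‖ ≤ 1 ∧ ‖Torus.timeDerivWithin (Set.Icc s (s + τ)) ψ r x‖ ≤ 1 ∧
    ∀ i, ‖Torus.partialDeriv i (ψ r) x‖ ≤ 1) →
    ∀ δ : ℝ, 0 < δ → ∀ᶠ N : ℕ in atTop,
    G N {z | speedCapOn (Φ N) z (Set.Icc s (s + τ)) ((n N : ℝ) ^ (1 / 24 : ℝ)) ∧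
    packCapOn (Φ N) z (Set.Icc s (s + τ)) (mesoRadius (n N)) σ η₂ ∧
    δ < |momDefect σ (Φ N) z (mesoRadius (n N)) s τ ψ|} ≤ ENNReal.ofReal (Real.exp (-(c₀ * n N))))
    (hKen : ∀ (s τ : ℝ), 0 ≤ s → 0 < τ → s + τ ≤ 1 →
    ∀ φ : ℝ → T3 → ℝ, Torus.IsSmoothSpaceTimeOn (Set.Icc s (s + τ)) φ →
    (∀ r ∈ Set.Icc s (s + τ), ∀ x, |φ r x| ≤ 1 ∧ |Torus.timeDerivWithin (Set.Icc s (s + τ)) φ r x| ≤ 1 ∧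
    ∀ i, |Torus.partialDeriv i (φ r) x| ≤ 1) →
    ∀ δ : ℝ, 0 < δ → ∀ᶠ N : ℕ in atTop,
    G N {z | speedCapOn (Φ N) z (Set.Icc s (s + τ)) ((n N : ℝ) ^ (1 / 24 : ℝ)) ∧
    packCapOn (Φ N) z (Set.Icc s (s + τ)) (mesoRadius (n N)) σ η₃ ∧
    δ < |enDefect σ (Φ N) z (mesoRadius (n N)) s τ φ|} ≤ ENNReal.ofReal (Real.exp (-(c₀ * n N)))),
    ∀ κ : ℝ, 0 < κ → ∀ᶠ N in atTop,
    Integrable (fun z => logProfileObs σ ρ θ u t ((Φ N).flow t z)) (P N) ∧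
    (∫ x, ρ t x * (Real.log (ρ t x) + gChem σ (ρ t x) - 3 / 2 * Real.log (2 * Real.pi * θ t x) - 3 / 2)) - κ ≤
    ∫ z, logProfileObs σ ρ θ u t ((Φ N).flow t z) ∂(P N)

/-- **Level 0 of the Grönwall assembly restated on the named dynamic theorem** (registered): the tree reduction `stub_reduction` (p130680)
applied to `DynamicTheorem` gives `OneMeanLowerBound` from the statics and the three equilibrium / a-priori inputs. [cite: Yau1991, §2] -/
theorem oneMeanLowerBound_of_dynamicTheorem : DynamicTheorem → MesoscaleSuperlinearityE → UniformPressureAlongSolution → GeneralFamilyStaticLLN → TiltDomination → MomentumClosureTightnessUR → EnergyClosureTightnessUR → TrueLawCapsG → OneMeanLowerBound :=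
  fun hD => stub_reduction hD

end Summit.AtomisticToContinuum.HydrodynamicLimit.Theorems.NearConstantShortTimeHL

end
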